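import Summits.Ventures.HSemireg.WedgeHankelSecantRank
import Summits.Ventures.HSemireg.WedgeHankelBox

/-!
# Venture HSemireg — SECANTS THROUGH THE POINT: `rank H_k(Σ_{i<r} A_i λ_i^• + c·δ_m) = r + 1` for `r + 1 ≤ min(k+1, m+1−k)`
# (the node at slope `∞` counts like any other)

HONEST FRAMING. Part of the Lean index of the computation cell `pub-hsemireg` (seat p10 gen 14, Sunday typer «UNIFORM-IN-n»).
LINEAR ALGEBRA OF HANKEL (catalecticant) MATRICES over a field ONLY: no variety, no cohomology theory, no sheaf, no Ext group and no
semiregularity map is constructed here; nothing here says that HC / HC_CM / HC_AV holds; no Literature fact is declared or used.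
Custodian versions cited: theory/FORMULA-N.md PART A §2.6 THEOREM H and its KRONECKER DICTIONARY («ρ = 1 pure (line bundle / 𝒪 / pt)»,
ρ = 2: `1 − pt`, the real pair, the `K`-secant); STRUCTURE.md v1.0-SIGNED 9b196a05977dd067 §1.1 C15.  The dictionary (`Σ_i A_i exp(λ_i Θ) + c·pt`
↦ the coefficient sequence `q_j = Σ_i A_i λ_i^j + c·[j = m]` ↦ th-7's Hankel class `w_m(q)`) is QUOTED, never asserted.

WHAT IS KEYED.  `WedgeHankelSecantRank` (D1): the SECANT RANK LAW `rank H_k(Σ_{i<r} A_i λ_i^•) = min(r, k+1)` (`r ≤ m+1−k`) by a Vandermonde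
minor; `WedgeHankelBox` (585): the two-ended sequence `ppSeq a c = (a, 0, …, 0, c)` of th-7's point pair, Hankel rank `2` (THEOREM T).
THIS FILE adds the node at slope `∞` — the POINT `c·δ_m` (`w_m(0,…,0,c) = c·E_{y-block}`, C7) — to the secant:
* §1 `psecSeq m A λ c = secSeq A λ + ppSeq m 0 c`; the PROJECTIVE NODE MATRICES `B'`, `V'` (the `r` weighted node rows, then the row
  `c·e_last`); **`hankel1_psecSeq`: `H_k(q) = B'ᵀ V'`** (`k ≤ m`: the point contributes the single corner entry `(k, m−k)`).
* §2 the PROJECTIVE VANDERMONDE MINOR: `B'ᵀ` is injective for `r + 1 ≤ c` columns, non-zero weights, `c ≠ 0`, distinct finite nodes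
  (`transpose_mulVecLin_injective_p`; the finite rows by D1's minor on the first `r` columns, the point row by the last column).
* §3 **`rank_hankel1_psecSeq`: `rank H_k(Σ_{i<r} A_i λ_i^• + c·δ_m) = r + 1` for `r + 1 ≤ k + 1`, `r + 1 ≤ m + 1 − k`** — the secant rank
  law with one node at infinity (`r = 0`: C7's point, rank `1`; `r = 1`, `λ = 0`: 585's point pair `(a, 0, …, 0, c)`, rank `2`); with
  THEOREM H the rank on `⋀^k` is `C(m,k)·(r+1)` and the kernel NUMBER is `C(2m,k) − (r+1)·C(m,k)` (`finrank_ker_wedge_w_psecSeq_add`) — its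
  NAME (`⋂_i F_{λ_i}(k) ∩ F_∞(k)`) is the next leaf.
Namespace `Summit.Ventures.HSemireg.Wedge.HankelSecant` (continued); new names only.
-/

open Module
open scoped Matrix

namespace Summit.Ventures.HSemireg.Wedge.HankelSecant

open Summit.Ventures.HSemireg.Wedge Summit.Ventures.HSemireg.Wedge.Hankel Summit.Ventures.HSemireg.Wedge.HankelBox

variable (K : Type*) [Field K]

/-! ## §1. Secants through the point and the projective node matrices -/

/-- the coefficient sequence of `Σ_{i<r} A_i exp(λ_i Θ) + c·pt` on an `m`-dimensional factor: `q_j = Σ_i A_i λ_i^j + c·[j = m]`. -/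
def psecSeq (m : ℕ) {r : ℕ} (A lam : Fin r → K) (c : K) : ℕ → K := secSeq K A lam + ppSeq K m 0 c

variable {K}

/-- values of the projective secant sequence. -/
lemma psecSeq_apply (m : ℕ) {r : ℕ} (A lam : Fin r → K) (c : K) (j : ℕ) :
    psecSeq K m A lam c j = (∑ i, A i * lam i ^ j) + (if j = m then c else 0) := by
  simp only [psecSeq, Pi.add_apply, secSeq, ppSeq, ite_self, zero_add]

/-- the PROJECTIVE WEIGHTED NODE MATRIX `B'` (`r + 1` rows, `cd` columns): the `r` finite rows `(A_i λ_i^l)_l`, then the point row `c·e_{last}`. -/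
def pNodeMat {r : ℕ} (A lam : Fin r → K) (c : K) (cd : ℕ) : Matrix (Fin (r + 1)) (Fin cd) K :=
  Matrix.of fun j l => if h : (j : ℕ) < r then A ⟨j, h⟩ * lam ⟨j, h⟩ ^ (l : ℕ) else (if (l : ℕ) + 1 = cd then c else 0)

/-- finite rows of `B'`. -/
lemma pNodeMat_castSucc {r : ℕ} (A lam : Fin r → K) (c : K) (cd : ℕ) (i : Fin r) (l : Fin cd) :
    pNodeMat A lam c cd (Fin.castSucc i) l = A i * lam i ^ (l : ℕ) := by
  simp only [pNodeMat, Matrix.of_apply, Fin.val_castSucc, i.isLt, dif_pos, Fin.eta]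

/-- the point row of `B'`. -/
lemma pNodeMat_last {r : ℕ} (A lam : Fin r → K) (c : K) (cd : ℕ) (l : Fin cd) :
    pNodeMat A lam c cd (Fin.last r) l = if (l : ℕ) + 1 = cd then c else 0 := by
  simp only [pNodeMat, Matrix.of_apply, Fin.val_last, lt_irrefl, dif_neg, not_false_eq_true]

/-- **`H_k(q) = B'ᵀ V'`** for a secant through the point (`k ≤ m`): the finite nodes give D1's `Bᵀ V`, the point the corner entry `(k, m − k)`. -/
theorem hankel1_psecSeq {m k : ℕ} (hk : k ≤ m) {r : ℕ} (A lam : Fin r → K) (c : K) :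
    hankel1 K m k (psecSeq K m A lam c) = (pNodeMat A lam c (k + 1))ᵀ * pNodeMat (fun _ => (1 : K)) lam 1 (m + 1 - k) := by
  ext i s
  rw [hankel1, Matrix.of_apply, psecSeq_apply, Matrix.mul_apply, Fin.sum_univ_castSucc]
  simp only [Matrix.transpose_apply, pNodeMat_castSucc, pNodeMat_last, one_mul, pow_add, mul_assoc]
  congr 1
  have hi := i.isLt; have hs := s.isLt
  by_cases him : (i : ℕ) + (s : ℕ) = m
  · rw [if_pos him, if_pos (by omega), if_pos (by omega), mul_one]
  · rw [if_neg him]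
    by_cases hik : (i : ℕ) + 1 = k + 1
    · rw [if_pos hik, if_neg (by omega), mul_zero]
    · rw [if_neg hik, zero_mul]

/-- hence `rank H_k ≤ r + 1` for a secant through the point (`k ≤ m`). -/
theorem rank_hankel1_psecSeq_le {m k : ℕ} (hk : k ≤ m) {r : ℕ} (A lam : Fin r → K) (c : K) :
    (hankel1 K m k (psecSeq K m A lam c)).rank ≤ r + 1 := by
  rw [hankel1_psecSeq hk]
  exact (Matrix.rank_mul_le_left _ _).trans ((Matrix.rank_le_width _).trans le_rfl)

/-! ## §2. The projective Vandermonde minor -/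

/-- **`B'ᵀ` is injective** for `r + 1 ≤ cd` columns, non-zero weights, `c ≠ 0` and distinct finite nodes: the first `r` columns see only the
finite rows (D1's Vandermonde minor kills their coefficients), the last column then kills the point's. -/
theorem transpose_mulVecLin_injective_p {r cd : ℕ} (hrc : r + 1 ≤ cd) {A lam : Fin r → K} (hA : ∀ i, A i ≠ 0) {c : K} (hc : c ≠ 0)
    (hlam : Function.Injective lam) : Function.Injective (pNodeMat A lam c cd)ᵀ.mulVecLin := by
  rw [← LinearMap.ker_eq_bot, LinearMap.ker_eq_bot']
  intro w hw
  have hw' : ∀ l : Fin cd, (∑ i : Fin r, w (Fin.castSucc i) * (A i * lam i ^ (l : ℕ))) +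
      w (Fin.last r) * (if (l : ℕ) + 1 = cd then c else 0) = 0 := by
    intro l
    have h := congrFun hw l
    simpa [Matrix.mulVecLin_apply, Matrix.mulVec_transpose, Matrix.vecMul, dotProduct, Fin.sum_univ_castSucc, pNodeMat_castSucc,
      pNodeMat_last] using h
  -- the finite part vanishes: D1's minor on the first `r` columns
  have hfin : (fun i => w (Fin.castSucc i)) = 0 := by
    have hinj := transpose_mulVecLin_injective (K := K) (le_refl r) hA hlam
    rw [← LinearMap.ker_eq_bot, LinearMap.ker_eq_bot'] at hinj
    refine hinj _ ?_
    funext l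
    have h := hw' ⟨l, by omega⟩
    rw [if_neg (show ¬ ((l : ℕ) + 1 = cd) by omega), mul_zero, add_zero] at h
    simpa [Matrix.mulVecLin_apply, Matrix.mulVec_transpose, Matrix.vecMul, dotProduct, wNodeMat] using h
  have hlast : w (Fin.last r) = 0 := by
    have h := hw' ⟨cd - 1, by omega⟩
    have hz : ∀ i : Fin r, w (Fin.castSucc i) = 0 := fun i => congrFun hfin i
    simp only [hz, zero_mul, Finset.sum_const_zero, zero_add] at h
    rw [if_pos (show cd - 1 + 1 = cd by omega), mul_eq_zero] at h
    exact h.resolve_right hc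
  funext j
  refine Fin.lastCases ?_ (fun i => ?_) j
  · exact hlast
  · exact congrFun hfin i

/-- `B'` has rank `r + 1` … -/
theorem rank_pNodeMat {r cd : ℕ} (hrc : r + 1 ≤ cd) {A lam : Fin r → K} (hA : ∀ i, A i ≠ 0) {c : K} (hc : c ≠ 0)
    (hlam : Function.Injective lam) : (pNodeMat A lam c cd).rank = r + 1 := by
  rw [← Matrix.rank_transpose, Matrix.rank, LinearMap.finrank_range_of_inj (transpose_mulVecLin_injective_p hrc hA hc hlam),
    finrank_fintype_fun_eq_card, Fintype.card_fin]

/-- … so `B'` is onto `K^{r+1}`. -/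
theorem range_pNodeMat_mulVecLin_eq_top {r cd : ℕ} (hrc : r + 1 ≤ cd) {A lam : Fin r → K} (hA : ∀ i, A i ≠ 0) {c : K} (hc : c ≠ 0)
    (hlam : Function.Injective lam) : LinearMap.range (pNodeMat A lam c cd).mulVecLin = ⊤ := by
  apply Submodule.eq_top_of_finrank_eq
  rw [← Matrix.rank, rank_pNodeMat hrc hA hc hlam, finrank_fintype_fun_eq_card, Fintype.card_fin]

/-! ## §3. The Hankel rank of a secant through the point -/

/-- **`rank H_k(Σ_{i<r} A_i λ_i^• + c·δ_m) = r + 1` for `r + 1 ≤ k + 1` and `r + 1 ≤ m + 1 − k`** (distinct finite nodes, non-zero weights,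
`c ≠ 0`; every field): the node at infinity counts like any other.  `r = 0`: the point (rank `1`, C7); `r = 1`, `λ = 0`: 585's two-ended
sequence `(a, 0, …, 0, c)` (rank `2`, THEOREM T). -/
theorem rank_hankel1_psecSeq {m k r : ℕ} (hrk : r + 1 ≤ k + 1) (hrm : r + 1 ≤ m + 1 - k) {A lam : Fin r → K} (hA : ∀ i, A i ≠ 0)
    {c : K} (hc : c ≠ 0) (hlam : Function.Injective lam) : (hankel1 K m k (psecSeq K m A lam c)).rank = r + 1 := by
  rw [hankel1_psecSeq (by omega), Matrix.rank, Matrix.mulVecLin_mul,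
    LinearMap.range_comp_of_range_eq_top _ (range_pNodeMat_mulVecLin_eq_top hrm (fun _ => one_ne_zero) one_ne_zero hlam),
    LinearMap.finrank_range_of_inj (transpose_mulVecLin_injective_p hrk hA hc hlam), finrank_fintype_fun_eq_card, Fintype.card_fin]

/-- with th-7's THEOREM H: **`rank(θ ↦ θ ∧ w_m(q) ∣ ⋀^k K^{2m}) = C(m,k)·(r+1)`** for the secant through the point, same range. -/
theorem finrank_range_wedge_w_psecSeq {m k r : ℕ} (hrk : r + 1 ≤ k + 1) (hrm : r + 1 ≤ m + 1 - k) {A lam : Fin r → K}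
    (hA : ∀ i, A i ≠ 0) {c : K} (hc : c ≠ 0) (hlam : Function.Injective lam) :
    finrank K (LinearMap.range (wedge K m k (w K m m (psecSeq K m A lam c)))) = m.choose k * (r + 1) := by
  rw [hankelLaw_model, rank_hankel1_psecSeq hrk hrm hA hc hlam]

/-- `dim ⋀^k K^{2m} = C(2m, k)` (private copy). -/
private lemma finrank_exteriorPower'' (m k : ℕ) : finrank K (⋀[K]^k (In m → K)) = (m + m).choose k := by
  rw [exteriorPower.finrank_eq, finrank_fintype_fun_eq_card, Fintype.card_fin]

/-- the kernel NUMBER: **`dim ker(θ ↦ θ ∧ w_m(q) ∣ ⋀^k) + (r+1)·C(m,k) = C(2m,k)`** for the secant through the point, same range. -/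
theorem finrank_ker_wedge_w_psecSeq_add {m k r : ℕ} (hrk : r + 1 ≤ k + 1) (hrm : r + 1 ≤ m + 1 - k) {A lam : Fin r → K}
    (hA : ∀ i, A i ≠ 0) {c : K} (hc : c ≠ 0) (hlam : Function.Injective lam) :
    finrank K (LinearMap.ker (wedge K m k (w K m m (psecSeq K m A lam c)))) + (r + 1) * m.choose k = (m + m).choose k := by
  have h := LinearMap.finrank_range_add_finrank_ker (wedge K m k (w K m m (psecSeq K m A lam c)))
  rw [finrank_range_wedge_w_psecSeq hrk hrm hA hc hlam, finrank_exteriorPower''] at h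
  rw [← h]; ring

end Summit.Ventures.HSemireg.Wedge.HankelSecant
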